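import Summits.QuantumAdvantage.QuantumAdvantage.Theorems.SosSandwichTransferPBMachineReduction
import Summits.QuantumAdvantage.QuantumAdvantage.Theorems.SosSandwichTransferPB
import HarnessLib

/-!
# `TransferPB` machine reduction with the influence hypothesis on RESTRICTION PATHS ONLY (toward weakening PB-AA to AA for quantum acceptance polynomials)

Route `SosSandwich`; repair census of crux `PseudoBoundedAA` (stmt-QuantumAdvantage-15237).  The closed crux `TransferPB`
(stmt-15238, `Theorems/SosSandwichTransferPB.lean`) consumes its antecedent `PseudoBoundedAA` (PB-AA on the whole SOS class
`K_T`) at exactly ONE point: `SimTreePB.complete_of_pb` inside `SimTreePB.measure_advTree_noVar_deviation_le_pb`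
(file `…TransferPBMachineReduction.lean`), i.e. only for the RESTRICTIONS `restrictPath ρ (acceptPoly F x)` of oracle-circuit
acceptance polynomials — which are acceptance probabilities of genuine quantum query algorithms (the oracle partially
fixed), not arbitrary members of `K_T`.  This file re-runs the root of the machine reduction with that minimal hypothesis:

* `measure_advTree_noVar_deviation_le_of_pathBound` — the deviation bound for the no-variance advised tree, granted the
  influence bound ALONG THE RESTRICTION PATHS of `p_x` only (proof verbatim, `complete_of_pb` replaced by the hypothesis);
* **`oracleSimulation_of_machines_of_pathBound`** — `OracleSimulation` from the SAME machine hypothesis as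
  `SimTreePB.oracleSimulation_of_machines` and the path-wise influence bound
  `AApath := ∃ c C₀ > 0, ∀ F x ρ ε, 0 < ε ≤ Var[p_x|_ρ] → ∃ i, C₀ (ε / thm23Degree F x)^c ≤ Inf_i[p_x|_ρ]`
  in place of `PseudoBoundedAA`;
* **`transfer_of_machines_of_pathBound`** — composed with the landed stubs 1 and 3 of `TransferPB` and the glue
  `TransferPBGlue.ae_BQPRel_subset_AvgPRel_of_simulation`: the ROOT MACHINE HYPOTHESIS + `AApath` +
  `PromiseBQP ⊆ PromiseBPP'` give `∀ᵐ A, BQP^A ⊆ AvgP^A` — the conclusion of `TransferPB` with PB-AA replaced by `AApath`,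
  modulo the machine hypothesis that the tree's nine-level chain (`…MachineReductionPick` → `…Pot` → `…AveragedPotential` →
  `…QueryMagnitude` → `…MachineSplitKept` → `…Descent` → `…DescentWalk` → `…EventMachineOSM` → `…EventOSMFinal`) discharges
  inside PB-AA-typed conclusions (re-threading those verbatim proofs with this root is the remaining, mechanical, job).
* `pathBound_of_pseudoBoundedAA` — PB-AA (with stub 1, `p_x ∈ K_{#gates}`) implies `AApath`, so this generalises the tree's root
  (`oracleSimulation_of_machines hmach h₁ hPB = oracleSimulation_of_machines_of_pathBound hmach h₁ (pathBound_of_pseudoBoundedAA h₁ hPB)`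
  up to proof irrelevance; not restated, gate dedup).

What it is for (planner-facing, honest label: a ROOT TWIN only): re-threading the four verbatim levels above the root
(`…QueryMagnitude.stub_pbOracleSimulation_of_bbbvMachines` → `…DescentWalk._of_stringMachines` → `…EventMachineOSM._of_eventOSM`
→ `…EventOSMFinal._of_Q`, whose machine hypotheses are discharged in the tree) with this root gives
`AApath → PromiseBQP ⊆ PromiseBPP' → ∀ᵐ A, BQP^A ⊆ AvgP^A`, i.e. the summit assembly of route SosSandwich with the
analytic crux weakened from PB-AA (`K_T`, homogeneous rung T-lossy and open) to an AA statement for quantum acceptance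
polynomials (`Q_T`-type, degree-free homogeneous rung PROVED: `QueryTopLevel.queryHomogeneousRung`).  Nothing here is new
about `TransferPB` itself (closed); no named fact; axioms standard.
Source: S. Aaronson, A. Ambainis, Theory Comput. 10 (2014), Thm. 21, Thm. 23 (proof, p. 14).
-/

-- D-0017: single-conjunct summit ⇒ the duplicate `QuantumAdvantage.QuantumAdvantage` is mandated.
set_option linter.dupNamespace false

noncomputable section

namespace Summit.QuantumAdvantage.QuantumAdvantage.Cruxes.TransferPB.Birth

open Finset MeasureTheory Literature.Computability.Cryptography Literature.Computability.Complexity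
  Literature.Computability.QuantumComplexity Literature.Computability.QuantumComplexity.ClassicalSimulation
open Summit.QuantumAdvantage.QuantumAdvantage.Theses.SosSandwich
open scoped ENNReal

namespace SimTreePB

namespace PathBound

variable {G : QGateSet} (F : QCircuitFamily G) (x : List Bool)

/-- **Deviation bound for the no-variance advised tree, from the influence bound along restriction paths.**  As
`SimTreePB.measure_advTree_noVar_deviation_le_pb`, but the influence hypothesis is demanded only for the restrictions
`p_x|_ρ` of the acceptance polynomial (`θ = ε²δ/2`, threshold `w = C₀((θ/2)/d)^c`, `d = thm23Degree F x`): if the influence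
answers are faithful for `w` vs `w/2`, the estimates `η`-accurate and the budget `D ≥ 8d/((w/2)δ)`, the advised tree deviates
from `Pr[F^A accepts x]` by more than `ε + η` with probability `≤ δ`. [cite: AaronsonAmbainis2014, Thm. 23 (proof, p. 14)] -/
theorem measure_advTree_noVar_deviation_le_of_pathBound {c : ℕ} {C₀ : ℝ} (hC₀ : 0 < C₀)
    (hK : PseudoBounded (F.circ x.length).oracleQueries (acceptPoly F x))
    {ε δ η : ℝ} (hε : 0 < ε) (hδ : 0 < δ)
    (hpath : ∀ ρ : List (Fin (numOracleBits F x) × Bool),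
      (ε ^ 2 * δ / 2) / 2 < boolVariance (restrictPath ρ (acceptPoly F x)) →
        ∃ i : Fin (numOracleBits F x),
          C₀ * (((ε ^ 2 * δ / 2) / 2) / thm23Degree F x) ^ c ≤ influence i (restrictPath ρ (acceptPoly F x)))
    {infBig : List (Fin (numOracleBits F x) × Bool) → Fin (numOracleBits F x) → Bool}
    {est : List (Fin (numOracleBits F x) × Bool) → ℝ}
    (hinf : ∀ (ρ : List (Fin (numOracleBits F x) × Bool)) (i : Fin (numOracleBits F x)),
      (C₀ * (((ε ^ 2 * δ / 2) / 2) / thm23Degree F x) ^ c ≤ influence i (restrictPath ρ (acceptPoly F x)) →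
          infBig ρ i = true) ∧
      (influence i (restrictPath ρ (acceptPoly F x)) ≤ (C₀ * (((ε ^ 2 * δ / 2) / 2) / thm23Degree F x) ^ c) / 2 →
          infBig ρ i = false))
    (hest : ∀ ρ : List (Fin (numOracleBits F x) × Bool),
      |est ρ - boolAvg (evalBool (restrictPath ρ (acceptPoly F x)))| ≤ η)
    {D : ℕ} (hD : 8 * (thm23Degree F x : ℝ) /
      ((C₀ * (((ε ^ 2 * δ / 2) / 2) / thm23Degree F x) ^ c) / 2 * δ) ≤ D) :
    randomOracleMeasure {A : Set (List Bool) |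
        ε + η < |(advTree (gapAdvisor ⟨fun _ => true, infBig, est⟩) D []).eval (oracleBits F x A) -
          F.acceptProbOn A x|} ≤ ENNReal.ofReal δ := by
  have hd1 : 1 ≤ thm23Degree F x := by unfold thm23Degree; omega
  have hTd : (F.circ x.length).oracleQueries ≤ thm23Degree F x := by unfold thm23Degree; omega
  have hdeg : (acceptPoly F x).totalDegree ≤ thm23Degree F x :=
    (totalDegree_acceptPoly_le F x).trans (by unfold thm23Degree; omega)
  set θ : ℝ := ε ^ 2 * δ / 2 with hθ
  have hθpos : 0 < θ := by positivity
  set w : ℝ := C₀ * ((θ / 2) / thm23Degree F x) ^ c with hw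
  have hwpos : 0 < w := by positivity
  have hS : (gapAdvisor ⟨fun _ => true, infBig, est⟩).Sound (acceptPoly F x) θ (w / 2) η :=
    gapAdvisor_noVar_sound hθpos.le hinf hest hpath
  exact measure_advTree_acceptPoly_deviation_le F x hd1 hdeg (hK.mono hTd).bounded hε hδ (half_pos hwpos) hS
    (by rwa [hw, hθ])

end PathBound

/-- **PB-AA implies the path-wise bound** (so `oracleSimulation_of_machines_of_pathBound` generalises the tree's root
`oracleSimulation_of_machines`): restrictions of `p_x ∈ K_{#gates} ⊆ K_d`, `d = thm23Degree F x ≥ 1`, stay in `K_d`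
(`pseudoBounded_restrictPath`), where PB-AA applies. [cite: AaronsonAmbainis2014, Thm. 23 (proof, p. 14)] -/
theorem pathBound_of_pseudoBoundedAA (h₁ : Sig.stub_oracleAcceptPseudoBounded) (hPB : PseudoBoundedAA) :
    ∃ (c : ℕ) (C₀ : ℝ), 0 < C₀ ∧ ∀ (F : QCircuitFamily cliffordT) (x : List Bool)
      (ρ : List (Fin (numOracleBits F x) × Bool)) (ε : ℝ), 0 < ε →
      ε ≤ boolVariance (restrictPath ρ (acceptPoly F x)) →
        ∃ i : Fin (numOracleBits F x),
          C₀ * (ε / thm23Degree F x) ^ c ≤ influence i (restrictPath ρ (acceptPoly F x)) := by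
  obtain ⟨c, C₀, hC₀, HPB⟩ := pbInfluenceBound_of_pseudoBoundedAA hPB
  refine ⟨c, C₀, hC₀, fun F x ρ ε hε hv => ?_⟩
  have hd1 : 1 ≤ thm23Degree F x := by unfold thm23Degree; omega
  have hTd : (F.circ x.length).oracleQueries ≤ thm23Degree F x := by unfold thm23Degree; omega
  exact HPB _ _ _ ε hd1 (pseudoBounded_restrictPath ρ ((h₁ F x).mono hTd)) hε hv

/-- **`OracleSimulation` from the machine half and the PATH-WISE influence bound.**  Same machine hypothesis as
`SimTreePB.oracleSimulation_of_machines` (for all `c k`: a `PromiseBQP` problem and a polynomial-time transcript machine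
producing the threshold bit of the advised tree), same proof, with `PseudoBoundedAA` replaced by
`AApath : ∃ c C₀ > 0, ∀ F x ρ ε, 0 < ε ≤ Var[p_x|_ρ] → ∃ i, C₀ (ε/thm23Degree F x)^c ≤ Inf_i[p_x|_ρ]` — the influence
bound for restrictions of quantum oracle-circuit acceptance polynomials only (stub 1 is kept for `0 ≤ p_x ≤ 1`).
[cite: AaronsonAmbainis2014, Thm. 23 (proof, p. 14)] -/
theorem oracleSimulation_of_machines_of_pathBound
    (hmach : ∀ (c k : ℕ) (F : QCircuitFamily cliffordT), F.IsUniform → ∀ r : Polynomial ℕ,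
      ∃ Q ∈ Literature.Computability.Cryptography.PromiseBQP, ∃ (C : OracleAlg Bool) (q : Polynomial ℕ),
        C.IsPolyTime Computability.encodingBoolBool ∧
        (∀ (O : Oracle) (x : List Bool), ∀ y ∈ C.queries O (q.eval x.length) x, y.length ≤ q.eval x.length) ∧
        ∀ x : List Bool, 1 ≤ x.length → ∀ g : List Bool → Bool,
          (∀ v ∈ Q.yes, g v = true) → (∀ v ∈ Q.no, g v = false) →
          ∃ (infBig : List (Fin (numOracleBits F x) × Bool) → Fin (numOracleBits F x) → Bool)
            (est : List (Fin (numOracleBits F x) × Bool) → ℝ),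
            (∀ (ρ : List (Fin (numOracleBits F x) × Bool)) (i : Fin (numOracleBits F x)),
              ((1 / 2 ^ k : ℝ) * ((((1 / 10 : ℝ) ^ 2 * (1 / (((r.eval x.length : ℕ) : ℝ) + 1)) / 2) / 2) /
                    thm23Degree F x) ^ c ≤ influence i (restrictPath ρ (acceptPoly F x)) → infBig ρ i = true) ∧
              (influence i (restrictPath ρ (acceptPoly F x)) ≤
                  ((1 / 2 ^ k : ℝ) * ((((1 / 10 : ℝ) ^ 2 * (1 / (((r.eval x.length : ℕ) : ℝ) + 1)) / 2) / 2) /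
                    thm23Degree F x) ^ c) / 2 → infBig ρ i = false)) ∧
            (∀ ρ : List (Fin (numOracleBits F x) × Bool),
              |est ρ - boolAvg (evalBool (restrictPath ρ (acceptPoly F x)))| ≤ 1 / 20) ∧
            ∀ A : Set (List Bool),
              C.run (Oracle.ofLanguage {w : List Bool | ∃ v : List Bool,
                  (w = false :: v ∧ v ∈ A) ∨ (w = true :: v ∧ g v = true)}) (q.eval x.length) x =
                some (decide (1 / 2 ≤
                  (advTree (gapAdvisor ⟨fun _ => true, infBig, est⟩)
                    (Nat.ceil (8 * (thm23Degree F x : ℝ) /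
                      (((1 / 2 ^ k : ℝ) * ((((1 / 10 : ℝ) ^ 2 * (1 / (((r.eval x.length : ℕ) : ℝ) + 1)) / 2) / 2) /
                          thm23Degree F x) ^ c) / 2 * (1 / (((r.eval x.length : ℕ) : ℝ) + 1)))))
                    []).eval (oracleBits F x A))))
    (h₁ : Sig.stub_oracleAcceptPseudoBounded)
    (hAA : ∃ (c : ℕ) (C₀ : ℝ), 0 < C₀ ∧ ∀ (F : QCircuitFamily cliffordT) (x : List Bool)
      (ρ : List (Fin (numOracleBits F x) × Bool)) (ε : ℝ), 0 < ε →
      ε ≤ boolVariance (restrictPath ρ (acceptPoly F x)) →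
        ∃ i : Fin (numOracleBits F x),
          C₀ * (ε / thm23Degree F x) ^ c ≤ influence i (restrictPath ρ (acceptPoly F x))) :
    OracleSimulation := by
  intro F hF r
  obtain ⟨c, C₀, hC₀, HAA⟩ := hAA
  -- dyadic rounding of the constant: `2^{-k} ≤ C₀`
  obtain ⟨k, hk⟩ := exists_pow_lt_of_lt_one hC₀ (by norm_num : (1 / 2 : ℝ) < 1)
  have hCk : (0 : ℝ) < 1 / 2 ^ k := by positivity
  have hkC : (1 / 2 ^ k : ℝ) ≤ C₀ := by
    have : ((1 / 2 : ℝ)) ^ k = 1 / 2 ^ k := by rw [div_pow, one_pow]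
    rw [← this]; exact hk.le
  have HAAk : ∀ (F : QCircuitFamily cliffordT) (x : List Bool) (ρ : List (Fin (numOracleBits F x) × Bool)) (ε : ℝ),
      0 < ε → ε ≤ boolVariance (restrictPath ρ (acceptPoly F x)) →
        ∃ i : Fin (numOracleBits F x),
          (1 / 2 ^ k : ℝ) * (ε / thm23Degree F x) ^ c ≤ influence i (restrictPath ρ (acceptPoly F x)) := by
    intro F x ρ ε hε hv
    obtain ⟨i, hi⟩ := HAA F x ρ ε hε hv
    exact ⟨i, le_trans (mul_le_mul_of_nonneg_right hkC (by positivity)) hi⟩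
  obtain ⟨Q, hQ, C, q, hCpoly, hCq, hC⟩ := hmach c k F hF r
  refine ⟨Q, hQ, C, q, hCpoly, hCq, fun x hx g hgy hgn => ?_⟩
  obtain ⟨infBig, est, hinf, hest, hrun⟩ := hC x hx g hgy hgn
  -- parameters
  set δ : ℝ := 1 / (((r.eval x.length : ℕ) : ℝ) + 1) with hδ
  have hδpos : 0 < δ := by positivity
  have hε : (0 : ℝ) < 1 / 10 := by norm_num
  set D : ℕ := Nat.ceil (8 * (thm23Degree F x : ℝ) /
    (((1 / 2 ^ k : ℝ) * (((((1 / 10 : ℝ)) ^ 2 * δ / 2) / 2) / thm23Degree F x) ^ c) / 2 * δ)) with hD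
  have hDle : 8 * (thm23Degree F x : ℝ) /
      (((1 / 2 ^ k : ℝ) * (((((1 / 10 : ℝ)) ^ 2 * δ / 2) / 2) / thm23Degree F x) ^ c) / 2 * δ) ≤ D :=
    Nat.le_ceil _
  have hpath : ∀ ρ : List (Fin (numOracleBits F x) × Bool),
      ((1 / 10 : ℝ) ^ 2 * δ / 2) / 2 < boolVariance (restrictPath ρ (acceptPoly F x)) →
        ∃ i : Fin (numOracleBits F x),
          (1 / 2 ^ k : ℝ) * ((((1 / 10 : ℝ) ^ 2 * δ / 2) / 2) / thm23Degree F x) ^ c ≤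
            influence i (restrictPath ρ (acceptPoly F x)) :=
    fun ρ hv => HAAk F x ρ _ (by positivity) hv.le
  have hdev := PathBound.measure_advTree_noVar_deviation_le_of_pathBound F x hCk (h₁ F x) hε hδpos
    (η := 1 / 20) hpath (infBig := infBig) (est := est) hinf hest hDle
  have hsub := threshold_subset_deviation F x
    (advTree (gapAdvisor ⟨fun _ => true, infBig, est⟩) D []) (ε := 1 / 10) (η := 1 / 20) (by norm_num)
  -- rewrite the run of `C` into the threshold bit and conclude
  have hset : {A : Set (List Bool) |
      (2 / 3 ≤ F.acceptProbOn A x ∧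
        C.run (Oracle.ofLanguage {w : List Bool | ∃ v : List Bool,
            (w = false :: v ∧ v ∈ A) ∨ (w = true :: v ∧ g v = true)}) (q.eval x.length) x ≠ some true) ∨
      (F.acceptProbOn A x ≤ 1 / 3 ∧
        C.run (Oracle.ofLanguage {w : List Bool | ∃ v : List Bool,
            (w = false :: v ∧ v ∈ A) ∨ (w = true :: v ∧ g v = true)}) (q.eval x.length) x ≠ some false)} =
      {A : Set (List Bool) |
        (2 / 3 ≤ F.acceptProbOn A x ∧
            decide (1 / 2 ≤ (advTree (gapAdvisor ⟨fun _ => true, infBig, est⟩) D []).eval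
              (oracleBits F x A)) ≠ true) ∨
          (F.acceptProbOn A x ≤ 1 / 3 ∧
            decide (1 / 2 ≤ (advTree (gapAdvisor ⟨fun _ => true, infBig, est⟩) D []).eval
              (oracleBits F x A)) ≠ false)} := by
    ext A
    simp only [Set.mem_setOf_eq, hrun A, ne_eq, Option.some.injEq]
  show (ProbabilityTheory.setBernoulli (Set.univ : Set (List Bool)) ⟨1 / 2, by norm_num, by norm_num⟩) _ ≤ _
  change randomOracleMeasure _ ≤ _
  rw [hset]
  exact (measure_mono hsub).trans hdev


/-! ### The transfer with the path-wise bound, modulo the root machine hypothesis -/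

/-- **`TransferPB`'s conclusion from `AApath` instead of PB-AA, modulo the root machine hypothesis.**  Granted the machine
hypothesis of `SimTreePB.oracleSimulation_of_machines` (discharged inside the tree's chain, but only behind PB-AA-typed
conclusions), the path-wise influence bound `AApath` and `PromiseBQP ⊆ PromiseBPP'`: `BQP^A ⊆ AvgP^A` for almost every random
oracle `A` (stub 1 `stub_oracleAcceptPseudoBounded` and stub 3 `stub_promiseOracleElimination` are tree theorems; glue
`TransferPBGlue.ae_BQPRel_subset_AvgPRel_of_simulation`). [cite: AaronsonAmbainis2014, Thm. 7(iii) and Thm. 23] -/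
theorem transfer_of_machines_of_pathBound
    (hmach : ∀ (c k : ℕ) (F : QCircuitFamily cliffordT), F.IsUniform → ∀ r : Polynomial ℕ,
      ∃ Q ∈ Literature.Computability.Cryptography.PromiseBQP, ∃ (C : OracleAlg Bool) (q : Polynomial ℕ),
        C.IsPolyTime Computability.encodingBoolBool ∧
        (∀ (O : Oracle) (x : List Bool), ∀ y ∈ C.queries O (q.eval x.length) x, y.length ≤ q.eval x.length) ∧
        ∀ x : List Bool, 1 ≤ x.length → ∀ g : List Bool → Bool,
          (∀ v ∈ Q.yes, g v = true) → (∀ v ∈ Q.no, g v = false) →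
          ∃ (infBig : List (Fin (numOracleBits F x) × Bool) → Fin (numOracleBits F x) → Bool)
            (est : List (Fin (numOracleBits F x) × Bool) → ℝ),
            (∀ (ρ : List (Fin (numOracleBits F x) × Bool)) (i : Fin (numOracleBits F x)),
              ((1 / 2 ^ k : ℝ) * ((((1 / 10 : ℝ) ^ 2 * (1 / (((r.eval x.length : ℕ) : ℝ) + 1)) / 2) / 2) /
                    thm23Degree F x) ^ c ≤ influence i (restrictPath ρ (acceptPoly F x)) → infBig ρ i = true) ∧
              (influence i (restrictPath ρ (acceptPoly F x)) ≤
                  ((1 / 2 ^ k : ℝ) * ((((1 / 10 : ℝ) ^ 2 * (1 / (((r.eval x.length : ℕ) : ℝ) + 1)) / 2) / 2) /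
                    thm23Degree F x) ^ c) / 2 → infBig ρ i = false)) ∧
            (∀ ρ : List (Fin (numOracleBits F x) × Bool),
              |est ρ - boolAvg (evalBool (restrictPath ρ (acceptPoly F x)))| ≤ 1 / 20) ∧
            ∀ A : Set (List Bool),
              C.run (Oracle.ofLanguage {w : List Bool | ∃ v : List Bool,
                  (w = false :: v ∧ v ∈ A) ∨ (w = true :: v ∧ g v = true)}) (q.eval x.length) x =
                some (decide (1 / 2 ≤
                  (advTree (gapAdvisor ⟨fun _ => true, infBig, est⟩)
                    (Nat.ceil (8 * (thm23Degree F x : ℝ) /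
                      (((1 / 2 ^ k : ℝ) * ((((1 / 10 : ℝ) ^ 2 * (1 / (((r.eval x.length : ℕ) : ℝ) + 1)) / 2) / 2) /
                          thm23Degree F x) ^ c) / 2 * (1 / (((r.eval x.length : ℕ) : ℝ) + 1)))))
                    []).eval (oracleBits F x A))))
    (hAA : ∃ (c : ℕ) (C₀ : ℝ), 0 < C₀ ∧ ∀ (F : QCircuitFamily cliffordT) (x : List Bool)
      (ρ : List (Fin (numOracleBits F x) × Bool)) (ε : ℝ), 0 < ε →
      ε ≤ boolVariance (restrictPath ρ (acceptPoly F x)) →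
        ∃ i : Fin (numOracleBits F x),
          C₀ * (ε / thm23Degree F x) ^ c ≤ influence i (restrictPath ρ (acceptPoly F x)))
    (hPr : Literature.Computability.Cryptography.PromiseBQP ⊆ Literature.Computability.Complexity.PromiseBPP') :
    ∀ᵐ A ∂randomOracle,
      BQPRel (A : Language Bool) ⊆
        Literature.Computability.Complexity.AvgPRel (Oracle.ofLanguage (A : Language Bool)) :=
  Summit.QuantumAdvantage.QuantumAdvantage.Theorems.SosSandwich.TransferPBGlue.ae_BQPRel_subset_AvgPRel_of_simulation
    (oracleSimulation_of_machines_of_pathBound hmach stub_oracleAcceptPseudoBounded hAA)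
    stub_promiseOracleElimination hPr

end SimTreePB

end Summit.QuantumAdvantage.QuantumAdvantage.Cruxes.TransferPB.Birth

end
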